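import Literature.Analysis.FluidPDE.BallMoments
import Mathlib.MeasureTheory.Measure.Lebesgue.VolumeOfBalls

/-!
# Radial moments of balls in `ℝ³`

Topic: Analysis/FluidPDE (support file; sequel of `Literature.Analysis.FluidPDE.BallMoments`, same
method). All proved, for the Euclidean space `ℝ³ = EuclideanSpace ℝ (Fin 3)`:

* `integral_ball_radial_fin_three` — polar coordinates on a ball:
  `∫_{|p| < R} f(|p|) dp = 4π ∫₀^R r² f(r) dr` (`R ≥ 0`; Mathlib's `integral_fun_norm_addHaar`
  and `EuclideanSpace.volume_ball_fin_three`);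
* `integral_ball_radial_mul_apply_sq_eq` — `∫_{|p| < R} g(|p|) pᵢ² dp` does not depend on the
  coordinate `i` (coordinate permutations are volume-preserving isometries);
* `integral_ball_radial_mul_norm_sq` — `∫_{|p| < R} g(|p|) |p|² dp = 4π ∫₀^R r⁴ g(r) dr`;
* `integral_ball_radial_mul_apply_sq` — `∫_{|p| < R} g(|p|) pᵢ² dp = (4π/3) ∫₀^R r⁴ g(r) dr`
  (`g` continuous: the three diagonal moments agree and sum to the radial one).

What is NOT here: general dimension `d` (only the constants change; `BallMoments` has the `|y|²` and
`yᵢ²` cases in every dimension), non-continuous weights.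

## References

* G. B. Folland, *Real Analysis*, 2nd ed. (1999), §2.7 Thm. 2.49 / Cor. 2.51 (integration in polar
  coordinates), Exercise 2.63 (moments of the ball). [Folland1999]
-/

noncomputable section

open MeasureTheory TopologicalSpace Set Function Filter Metric Module Real
open scoped ENNReal NNReal

namespace Literature.Analysis.FluidPDE

/-- The unit ball of `ℝ³` has real volume `4π/3` (`= π^{3/2}/Γ(5/2)`). [cite: Folland1999, Cor. 2.55] -/
theorem volume_real_ball_zero_one_fin_three :
    (volume (ball (0 : EuclideanSpace ℝ (Fin 3)) 1)).toReal = 4 * π / 3 := by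
  rw [EuclideanSpace.volume_ball_fin_three, ENNReal.toReal_mul, ← ENNReal.ofReal_pow zero_le_one,
    ENNReal.toReal_ofReal (by positivity), ENNReal.toReal_ofReal (by positivity)]
  ring

/-- **Polar coordinates on a ball of `ℝ³`**: `∫_{|p| < R} f(|p|) dp = 4π ∫₀^R r² f(r) dr` for
`R ≥ 0` and any `f : ℝ → ℝ`. [cite: Folland1999, Thm. 2.49] -/
theorem integral_ball_radial_fin_three (f : ℝ → ℝ) {R : ℝ} (hR : 0 ≤ R) :
    ∫ p in ball (0 : EuclideanSpace ℝ (Fin 3)) R, f ‖p‖ = 4 * π * ∫ r in (0 : ℝ)..R, r ^ 2 * f r := by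
  have hind : (ball (0 : EuclideanSpace ℝ (Fin 3)) R).indicator (fun p => f ‖p‖) =
      fun p : EuclideanSpace ℝ (Fin 3) => (Iio R).indicator f ‖p‖ := by
    funext p
    by_cases hp : ‖p‖ < R
    · simp [indicator, hp]
    · simp [indicator, hp]
  rw [← integral_indicator measurableSet_ball, hind,
    integral_fun_norm_addHaar (volume : Measure (EuclideanSpace ℝ (Fin 3))) ((Iio R).indicator f),
    finrank_euclideanSpace, Fintype.card_fin]
  have hinner : ∫ y in Ioi (0 : ℝ), y ^ (3 - 1) • (Iio R).indicator f y =
      ∫ r in (0 : ℝ)..R, r ^ 2 * f r := by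
    have h1 : EqOn (fun y : ℝ => y ^ (3 - 1) • (Iio R).indicator f y)
        ((Iio R).indicator fun y : ℝ => y ^ 2 * f y) (Ioi 0) := by
      intro y _
      by_cases hy : y < R
      · simp [indicator, hy]
      · simp [indicator, hy]
    rw [setIntegral_congr_fun measurableSet_Ioi h1, setIntegral_indicator measurableSet_Iio,
      Ioi_inter_Iio, ← integral_Ioc_eq_integral_Ioo, ← intervalIntegral.integral_of_le hR]
  rw [hinner, measureReal_def, volume_real_ball_zero_one_fin_three]
  simp only [nsmul_eq_mul, smul_eq_mul, Nat.cast_ofNat]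
  ring

/-- A radial weight times a squared coordinate is integrable on a ball (`g` continuous; plumbing).
[folklore] -/
private theorem integrableOn_ball_radial_mul_apply_sq {g : ℝ → ℝ} (hg : Continuous g) (i : Fin 3) (R : ℝ) :
    IntegrableOn (fun p : EuclideanSpace ℝ (Fin 3) => g ‖p‖ * p i ^ 2) (ball 0 R) volume :=
  (((hg.comp continuous_norm).mul
      ((continuous_apply i |>.comp (PiLp.continuous_ofLp 2 _)).pow 2)).continuousOn.integrableOn_compact
      (isCompact_closedBall (0 : EuclideanSpace ℝ (Fin 3)) R)).mono_set ball_subset_closedBall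

/-- **The weighted diagonal moments do not depend on the coordinate**:
`∫_{|p| < R} g(|p|) pᵢ² dp = ∫_{|p| < R} g(|p|) pⱼ² dp` (the coordinate swap is a volume-preserving
isometry fixing `|p|` and the ball). [cite: Folland1999, Exercise 2.63] -/
theorem integral_ball_radial_mul_apply_sq_eq (g : ℝ → ℝ) (R : ℝ) (i j : Fin 3) :
    ∫ p in ball (0 : EuclideanSpace ℝ (Fin 3)) R, g ‖p‖ * p j ^ 2 =
      ∫ p in ball (0 : EuclideanSpace ℝ (Fin 3)) R, g ‖p‖ * p i ^ 2 := by
  set P := LinearIsometryEquiv.piLpCongrLeft 2 ℝ ℝ (Equiv.swap i j) with hP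
  have hmp : MeasurePreserving P volume volume := P.measurePreserving
  have hemb : MeasurableEmbedding P := P.toHomeomorph.measurableEmbedding
  have hpre : P ⁻¹' ball (0 : EuclideanSpace ℝ (Fin 3)) R = ball 0 R := by
    ext y
    simp [hP]
  have h := hmp.setIntegral_preimage_emb hemb
    (fun y : EuclideanSpace ℝ (Fin 3) => g ‖y‖ * y i ^ 2) (ball 0 R)
  rw [hpre] at h
  have hP' : ∀ y : EuclideanSpace ℝ (Fin 3), P y i = y j := fun y => by
    rw [hP, LinearIsometryEquiv.piLpCongrLeft_apply, Equiv.piCongrLeft'_apply,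
      Equiv.symm_swap, Equiv.swap_apply_left]
  have hPn : ∀ y : EuclideanSpace ℝ (Fin 3), ‖P y‖ = ‖y‖ := fun y => P.norm_map y
  simp only [hP', hPn] at h
  exact h

/-- **Radial second moment**: `∫_{|p| < R} g(|p|) |p|² dp = 4π ∫₀^R r⁴ g(r) dr` (`R ≥ 0`).
[cite: Folland1999, Cor. 2.51] -/
theorem integral_ball_radial_mul_norm_sq (g : ℝ → ℝ) {R : ℝ} (hR : 0 ≤ R) :
    ∫ p in ball (0 : EuclideanSpace ℝ (Fin 3)) R, g ‖p‖ * ‖p‖ ^ 2 =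
      4 * π * ∫ r in (0 : ℝ)..R, r ^ 4 * g r := by
  rw [integral_ball_radial_fin_three (fun r => g r * r ^ 2) hR]
  congr 1
  refine intervalIntegral.integral_congr fun r _ => ?_
  show r ^ 2 * (g r * r ^ 2) = r ^ 4 * g r
  ring

/-- **Weighted diagonal second moment of a ball of `ℝ³`**:
`∫_{|p| < R} g(|p|) pᵢ² dp = (4π/3) ∫₀^R r⁴ g(r) dr` for continuous `g` and `R ≥ 0` (the three
diagonal moments agree and sum to the radial one). [cite: Folland1999, Exercise 2.63] -/
theorem integral_ball_radial_mul_apply_sq {g : ℝ → ℝ} (hg : Continuous g) {R : ℝ} (hR : 0 ≤ R)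
    (i : Fin 3) :
    ∫ p in ball (0 : EuclideanSpace ℝ (Fin 3)) R, g ‖p‖ * p i ^ 2 =
      4 * π / 3 * ∫ r in (0 : ℝ)..R, r ^ 4 * g r := by
  -- the three diagonal moments sum to the radial moment
  have hsum : ∫ p in ball (0 : EuclideanSpace ℝ (Fin 3)) R, g ‖p‖ * ‖p‖ ^ 2 =
      ∑ j : Fin 3, ∫ p in ball (0 : EuclideanSpace ℝ (Fin 3)) R, g ‖p‖ * p j ^ 2 := by
    rw [← integral_finsetSum Finset.univ fun j _ => integrableOn_ball_radial_mul_apply_sq hg j R]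
    refine integral_congr_ae (ae_of_all _ fun p => ?_)
    show g ‖p‖ * ‖p‖ ^ 2 = ∑ j : Fin 3, g ‖p‖ * p j ^ 2
    rw [EuclideanSpace.real_norm_sq_eq p, Finset.mul_sum]
  simp only [integral_ball_radial_mul_apply_sq_eq g R i, Finset.sum_const, Finset.card_univ,
    Fintype.card_fin, nsmul_eq_mul, Nat.cast_ofNat] at hsum
  rw [integral_ball_radial_mul_norm_sq g hR] at hsum
  linarith

end Literature.Analysis.FluidPDE

end
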